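import Literature.NumberTheory.EllipticCurves.CastellaHsuKunduLeeLiu2025.SignedBipartiteEulerSystem
import Literature.NumberTheory.EllipticCurves.ZhangLevelRaisedKolyvaginData
import Literature.MeasureTheory.Group.PadicIntGLnVolume
import HarnessLib

/-!
# Line `admdef` v5, cell β: the non-vanishing [NV] (`SignedBipartiteSystem.HasUnitLambda`) is a
# MOD-`p`, LEVEL-ONE statement (crux `AnticyclotomicEisensteinDivisibility`, stmt-BirchSwinnertonDyer-20727)

Lead seat bsd-line-sbc-p1 (gen 16), `--supports stmt-BirchSwinnertonDyer-20727`.  The two cell-β research stubs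
of `Lines/admdef.lean` v5 (`stub_bipartiteNV_twoMult`, `stub_bipartiteNV_leOneMult`) end in the criterion of
Castella–Hsu–Kundu–Lee–Liu 2025 Thm. 7.5 / Howard 2006 Thm. 3.2.3 (c), typed as
`CastellaHsuKunduLeeLiu2025.SignedBipartiteSystem.HasUnitLambda B N` = "for some `j > 0` there exists
`m ∈ 𝒩_j^def` such that `λ_j(m)` has non-zero image in `Λ/𝔪 ≃ 𝔽_p`" = `∃ j > 0, ∃ m ∈ defProducts … j,
IsUnit (constantCoeff (B.lam j m))`.  THIS FILE (PROVED bookkeeping on the typed structure, for the port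
chain of the LEAD memo `Lines/admdef-lead-g16.md` §3): for a signed bipartite SYSTEM `B`
(`IsSignedBipartiteSystem … N ε B`),

* `defProducts_anti` — `𝒩_{j'}^def ⊆ 𝒩_j^def` for `j ≤ j'`;
* `p_dvd_constantCoeff_lam_sub` — `p ∣ λ_j(m)(0) − λ_1(m)(0)` for `j > 0`, `m ∈ 𝒩_j^def` (from `lam_compat`:
  `λ_{k+1}(m) − λ_k(m) ∈ (p^k)`);
* `isUnit_constantCoeff_lam_iff_level_one` — `λ_j(m)(0) ∈ ℤ_pˣ ⟺ λ_1(m)(0) ∈ ℤ_pˣ`;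
* `hasUnitLambda_iff_level_one` — **`B.HasUnitLambda N ⟺ ∃ m ∈ 𝒩_1^def, λ_1(m)(0) ∈ ℤ_pˣ`**;
* `hasUnitLambda_iff_toZMod_ne_zero` — **`B.HasUnitLambda N ⟺ ∃ m ∈ 𝒩_1^def, (λ_1(m)(0) mod p) ≠ 0` in
  `ZMod p`** (the residue criterion `IsUnit x ↔ toZMod x ≠ 0` is the tree's
  `Literature.MeasureTheory.Group.padicInt_isUnit_iff_toZMod_ne_zero`) — the shape of W. Zhang's definite values `λ(1, m) ∈ 𝔽_p` (tree:
  `WZhang2014.LevelRaisedBipartiteData.value m 1`), to which the printed non-vanishing argument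
  (CHKLL25 §7.4) reduces [NV];
* §3 the INDEX DICTIONARY with W. Zhang's levels (`IsZhangAdmissibleLevel N K a p s` on finite sets of
  1-admissible primes, file `ZhangLevelRaisedKolyvaginData`): `mem_defProducts_one_iff`,
  `prod_mem_defProducts_one`, and `hasUnitLambda_iff_exists_oddLevel` — **`B.HasUnitLambda N ⟺ ∃ s`, a finite
  set of 1-admissible primes of ODD cardinality, with `(λ_1(∏ s)(0) mod p) ≠ 0`**.

All PROVED (standard axioms); no definition, no named fact, no `sorry`.  BSD / the crux / [NV] are NOT
proved by this file.
-/

-- D-0017: single-problem summit, the namespace repeats the problem name by design.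
set_option linter.dupNamespace false
set_option autoImplicit false

noncomputable section

open scoped Classical

open Literature.NumberTheory.EllipticCurves Literature.NumberTheory.EllipticCurves.CastellaHsuKunduLeeLiu2025

namespace Summit.BirchSwinnertonDyer.BirchSwinnertonDyer.Theorems.SignedBaseChangeAcDivAdmdefBipartiteNVLevelOne

/-! ## §1 Levels: `𝒩_{j'}^def ⊆ 𝒩_j^def` -/

section Products

variable {N : ℕ} {K : Type} [Field K] {a : ℕ → ℤ} {p : ℕ}

/-- `𝒩_{j'}^def ⊆ 𝒩_j^def` for `j ≤ j'` (a `j'`-admissible prime is `j`-admissible; the parity of the number of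
prime factors does not change). [cite: Howard2006, §3.2 (15)] [cite: BertoliniDarmon2005, p. 18 (Admissible primes)] -/
theorem defProducts_anti {j j' : ℕ} (h : j ≤ j') : defProducts N K a p j' ⊆ defProducts N K a p j :=
  fun _ hm ↦ ⟨admissibleProducts_anti h hm.1, hm.2⟩

end Products

/-! ## §2 `λ_j(m)(0) ≡ λ_1(m)(0) (mod p)` and the level-one form of `HasUnitLambda` -/

section LevelOne

variable {W : WeierstrassCurve ℚ} [W.IsGloballyMinimal] {K : Type} [Field K] [NumberField K] {p : ℕ}
  [Fact p.Prime] {κ : ZpExtension K p} {γ : Field.absoluteGaloisGroup K} {N : ℕ} {ε : ℤˣ}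
  {B : SignedBipartiteSystem W K p κ}

/-- The constant coefficient of an element of the ideal `(C (p^k))` of `Λ = ℤ_p⟦T⟧` is divisible by `p^k`.
[cite: Howard2006, §3.2 (15)] -/
theorem pow_dvd_constantCoeff_of_mem_span {k : ℕ} {x : IwasawaAlgebra p}
    (hx : x ∈ Ideal.span {PowerSeries.C ((p : ℤ_[p]) ^ k)}) :
    (p : ℤ_[p]) ^ k ∣ PowerSeries.constantCoeff x := by
  obtain ⟨a, rfl⟩ := Ideal.mem_span_singleton'.1 hx
  exact ⟨PowerSeries.constantCoeff a, by rw [map_mul, PowerSeries.constantCoeff_C, mul_comm]⟩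

/-- **`p ∣ λ_j(m)(0) − λ_1(m)(0)`** for a signed bipartite system, `j > 0`, `m ∈ 𝒩_j^def`: iterate the
compatibility `λ_{k+1}(m) − λ_k(m) ∈ (p^k)` (`lam_compat`) down to level one.
[cite: CastellaEtAl2025, Thm. 7.4 (arXiv:2308.10474v2 p0030 L57–L62)] [cite: Howard2006, §3.2 (15)] -/
theorem p_dvd_constantCoeff_lam_sub (hB : IsSignedBipartiteSystem W K p κ γ N ε B) {j : ℕ} (hj : 0 < j)
    {m : ℕ} (hm : m ∈ defProducts N K (fun ℓ ↦ W.frobeniusTrace ℓ) p j) :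
    (p : ℤ_[p]) ∣ PowerSeries.constantCoeff (B.lam j m) - PowerSeries.constantCoeff (B.lam 1 m) := by
  induction j with
  | zero => exact absurd hj (lt_irrefl 0)
  | succ k ih =>
    rcases Nat.eq_zero_or_pos k with rfl | hk
    · simp
    · have hmk : m ∈ defProducts N K (fun ℓ ↦ W.frobeniusTrace ℓ) p k := defProducts_anti (Nat.le_succ k) hm
      have h1 : (p : ℤ_[p]) ∣
          PowerSeries.constantCoeff (B.lam (k + 1) m) - PowerSeries.constantCoeff (B.lam k m) := by
        have hmem := hB.lam_compat k m hk hm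
        have hdvd := pow_dvd_constantCoeff_of_mem_span hmem
        rw [map_sub] at hdvd
        exact (dvd_pow_self (p : ℤ_[p]) hk.ne').trans hdvd
      have h2 := ih hk hmk
      have : PowerSeries.constantCoeff (B.lam (k + 1) m) - PowerSeries.constantCoeff (B.lam 1 m) =
          (PowerSeries.constantCoeff (B.lam (k + 1) m) - PowerSeries.constantCoeff (B.lam k m)) +
            (PowerSeries.constantCoeff (B.lam k m) - PowerSeries.constantCoeff (B.lam 1 m)) := by ring
      rw [this]
      exact dvd_add h1 h2

/-- In `ℤ_p`, two elements congruent mod `p` are units together. [cite: Howard2006, Thm. 3.2.3 (c)] -/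
theorem isUnit_iff_of_p_dvd_sub {x y : ℤ_[p]} (h : (p : ℤ_[p]) ∣ x - y) : IsUnit x ↔ IsUnit y := by
  have hmem : x - y ∈ IsLocalRing.maximalIdeal ℤ_[p] := by
    rw [PadicInt.maximalIdeal_eq_span_p]
    exact Ideal.mem_span_singleton.2 h
  constructor
  · intro hx
    by_contra hy
    have hy' : y ∈ IsLocalRing.maximalIdeal ℤ_[p] := (IsLocalRing.mem_maximalIdeal y).2 hy
    have hx' : x ∈ IsLocalRing.maximalIdeal ℤ_[p] := by
      have := Ideal.add_mem _ hmem hy'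
      simpa using this
    exact (IsLocalRing.mem_maximalIdeal x).1 hx' hx
  · intro hy
    by_contra hx
    have hx' : x ∈ IsLocalRing.maximalIdeal ℤ_[p] := (IsLocalRing.mem_maximalIdeal x).2 hx
    have hy' : y ∈ IsLocalRing.maximalIdeal ℤ_[p] := by
      have := Ideal.sub_mem _ hx' hmem
      simpa using this
    exact (IsLocalRing.mem_maximalIdeal y).1 hy' hy

/-- **`λ_j(m)(0) ∈ ℤ_pˣ ⟺ λ_1(m)(0) ∈ ℤ_pˣ`** (`j > 0`, `m ∈ 𝒩_j^def`). [cite: CastellaEtAl2025, Thm. 7.5 (arXiv:2308.10474v2 p0031 L17–L20)] -/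
theorem isUnit_constantCoeff_lam_iff_level_one (hB : IsSignedBipartiteSystem W K p κ γ N ε B) {j : ℕ}
    (hj : 0 < j) {m : ℕ} (hm : m ∈ defProducts N K (fun ℓ ↦ W.frobeniusTrace ℓ) p j) :
    IsUnit (PowerSeries.constantCoeff (B.lam j m)) ↔ IsUnit (PowerSeries.constantCoeff (B.lam 1 m)) :=
  isUnit_iff_of_p_dvd_sub (p_dvd_constantCoeff_lam_sub hB hj hm)

/-- **[NV] is a level-one statement: `B.HasUnitLambda N ⟺ ∃ m ∈ 𝒩_1^def, λ_1(m)(0) ∈ ℤ_pˣ`** (a witness at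
level `j` is a witness at level `1` by `𝒩_j^def ⊆ 𝒩_1^def` and `λ_j(m) ≡ λ_1(m) (mod p)`).
[cite: CastellaEtAl2025, Thm. 7.5 (arXiv:2308.10474v2 p0031 L17–L20)] [cite: Howard2006, Thm. 3.2.3 (c)] -/
theorem hasUnitLambda_iff_level_one (hB : IsSignedBipartiteSystem W K p κ γ N ε B) :
    B.HasUnitLambda N ↔
      ∃ m ∈ defProducts N K (fun ℓ ↦ W.frobeniusTrace ℓ) p 1, IsUnit (PowerSeries.constantCoeff (B.lam 1 m)) := by
  constructor
  · rintro ⟨j, hj, m, hm, hu⟩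
    exact ⟨m, defProducts_anti hj hm, (isUnit_constantCoeff_lam_iff_level_one hB hj hm).1 hu⟩
  · rintro ⟨m, hm, hu⟩
    exact ⟨1, one_pos, m, hm, hu⟩

/-- **[NV] in W. Zhang's currency: `B.HasUnitLambda N ⟺ ∃ m ∈ 𝒩_1^def, (λ_1(m)(0) mod p) ≠ 0` in `𝔽_p`** —
the shape of the definite values `λ(1, m) ∈ 𝔽_p` of the mod-`p` level-raised bipartite datum (tree:
`WZhang2014.LevelRaisedBipartiteData.value m 1`), to which CHKLL25 §7.4 ("by Theorem 7.5 and the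
construction of `λ±_j` … it suffices to show that … `L±_p(g/K)` is invertible") reduces the criterion.
[cite: CastellaEtAl2025, Thm. 7.5 and §7.4 (arXiv:2308.10474v2 p0031 L17–L20, p0033 L2–L5)] [cite: WZhang2014, (4.7)–(4.9)] -/
theorem hasUnitLambda_iff_toZMod_ne_zero (hB : IsSignedBipartiteSystem W K p κ γ N ε B) :
    B.HasUnitLambda N ↔
      ∃ m ∈ defProducts N K (fun ℓ ↦ W.frobeniusTrace ℓ) p 1,
        PadicInt.toZMod (PowerSeries.constantCoeff (B.lam 1 m)) ≠ 0 := by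
  rw [hasUnitLambda_iff_level_one hB]
  simp only [Literature.MeasureTheory.Group.padicInt_isUnit_iff_toZMod_ne_zero]

end LevelOne

/-! ## §3 Index dictionary with W. Zhang's admissible levels (finite sets of 1-admissible primes) -/

section Dictionary

variable {N : ℕ} {K : Type} [Field K] {a : ℕ → ℤ} {p : ℕ}

/-- `m ∈ 𝒩_1^def` iff `m` is square-free, its set of prime factors is a Zhang admissible level
(`IsZhangAdmissibleLevel`: every member is Bertolini–Darmon 1-admissible) and has odd cardinality.
[cite: WZhang2014, Notations (xiv) (p. 202)] [cite: CastellaEtAl2025, §7.2 (arXiv:2308.10474v2 p0030 L1–L6)] -/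
theorem mem_defProducts_one_iff {m : ℕ} :
    m ∈ defProducts N K a p 1 ↔
      Squarefree m ∧ IsZhangAdmissibleLevel N K a p m.primeFactors ∧ Odd m.primeFactors.card := by
  simp only [mem_defProducts_iff, mem_admissibleProducts_iff, IsZhangAdmissibleLevel, Nat.mem_primeFactors]
  constructor
  · rintro ⟨⟨hsq, hadm⟩, hodd⟩
    exact ⟨hsq, fun q ⟨hq, hqm, _⟩ ↦ hadm q hq hqm, hodd⟩
  · rintro ⟨hsq, hadm, hodd⟩
    exact ⟨⟨hsq, fun q hq hqm ↦ hadm q ⟨hq, hqm, hsq.ne_zero⟩⟩, hodd⟩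

/-- The product of a Zhang admissible level of odd cardinality lies in `𝒩_1^def` (distinct primes give a
square-free product whose prime factors are the given set). [cite: WZhang2014, Notations (xiv) (p. 202)] -/
theorem prod_mem_defProducts_one {s : Finset ℕ} (hs : IsZhangAdmissibleLevel N K a p s) (hodd : Odd s.card) :
    (∏ q ∈ s, q) ∈ defProducts N K a p 1 := by
  have hprime : ∀ q ∈ s, q.Prime := fun q hq ↦ (hs q hq).prime
  rw [mem_defProducts_one_iff, Nat.primeFactors_prod hprime]
  refine ⟨?_, hs, hodd⟩
  refine Finset.squarefree_prod_of_pairwise_isCoprime ?_ fun q hq ↦ (hprime q hq).prime.squarefree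
  intro q hq r hr hqr
  exact Nat.coprime_iff_isRelPrime.mp ((Nat.coprime_primes (hprime q hq) (hprime r hr)).mpr hqr)

/-- From `m ∈ 𝒩_1^def`: its prime factors form a Zhang admissible level of odd cardinality with product `m`.
[cite: WZhang2014, Notations (xiv) (p. 202)] -/
theorem isZhangAdmissibleLevel_primeFactors_of_mem {m : ℕ} (hm : m ∈ defProducts N K a p 1) :
    IsZhangAdmissibleLevel N K a p m.primeFactors ∧ Odd m.primeFactors.card ∧ ∏ q ∈ m.primeFactors, q = m :=
  ⟨(mem_defProducts_one_iff.1 hm).2.1, (mem_defProducts_one_iff.1 hm).2.2,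
    Nat.prod_primeFactors_of_squarefree (mem_defProducts_one_iff.1 hm).1⟩

variable {W : WeierstrassCurve ℚ} [W.IsGloballyMinimal] [NumberField K] [Fact p.Prime] {κ : ZpExtension K p}
  {γ : Field.absoluteGaloisGroup K} {ε : ℤˣ} {B : SignedBipartiteSystem W K p κ}

/-- **[NV] over Zhang's index set: `B.HasUnitLambda N ⟺` there is a finite set `s` of 1-admissible primes
of ODD cardinality with `(λ_1(∏ s)(0) mod p) ≠ 0` in `𝔽_p`** — the exact shape in which a bridge to the
definite values `WZhang2014.LevelRaisedBipartiteData.value s 1` can be stated.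
[cite: CastellaEtAl2025, Thm. 7.5 and §7.4 (arXiv:2308.10474v2 p0031, p0033)] [cite: WZhang2014, Notations (xiv), (4.7)–(4.9)] -/
theorem hasUnitLambda_iff_exists_oddLevel (hB : IsSignedBipartiteSystem W K p κ γ N ε B) :
    B.HasUnitLambda N ↔
      ∃ s : Finset ℕ, IsZhangAdmissibleLevel N K (fun ℓ ↦ W.frobeniusTrace ℓ) p s ∧ Odd s.card ∧
        PadicInt.toZMod (PowerSeries.constantCoeff (B.lam 1 (∏ q ∈ s, q))) ≠ 0 := by
  rw [hasUnitLambda_iff_toZMod_ne_zero hB]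
  constructor
  · rintro ⟨m, hm, hne⟩
    obtain ⟨hs, hodd, hprod⟩ := isZhangAdmissibleLevel_primeFactors_of_mem hm
    exact ⟨m.primeFactors, hs, hodd, by rwa [hprod]⟩
  · rintro ⟨s, hs, hodd, hne⟩
    exact ⟨∏ q ∈ s, q, prod_mem_defProducts_one hs hodd, hne⟩

end Dictionary

end Summit.BirchSwinnertonDyer.BirchSwinnertonDyer.Theorems.SignedBaseChangeAcDivAdmdefBipartiteNVLevelOne

end
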